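import Summits.Schanuel.Schanuel.Theses.RoyCriterion
import Literature.Barriers.Schanuel.NesterenkoModularScopeHolds
import Literature.Barriers.Schanuel.NesterenkoModularScopeConjectureProofs
import Literature.Barriers.Schanuel.LargeTranscendenceDegree
import Literature.NumberTheory.Transcendental.OneMotiveToric

-- `Summit.Schanuel.Schanuel.…` is the mandated layout of this single-problem summit (CONVENTIONS §1).
set_option linter.dupNamespace false

/-!
# Route `RoyCriterion`, crux `SchanuelTwo` (stmt-Schanuel-0069), line `CardA_BW` (skeleton v2) —
# stub `stub_modularSector`: the modular-rich sector via Nesterenko 1996 Theorem 1.1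

The crux is Schanuel's conjecture for `n = 2`: for `x : Fin 2 → ℂ` linearly independent over `ℚ`,
`2 ≤ trdeg_ℚ K_x` with `K_x = ℚ(x, e^x) = IntermediateField.adjoin ℚ (range x ∪ range (exp ∘ x))`.
Line `CardA_BW` is a sector atlas; this file is the MODULAR-RICH sector: if for some nome `q`
with `0 < |q| < 1` the number `q` and TWO of Ramanujan's `P(q), Q(q), R(q)` (Eisenstein
`E₂, E₄, E₆` at `q`) are algebraic over `K_x`, then `2 ≤ trdeg_ℚ K_x`. The hypothesis is phrased
as a set equality `{u, v, w} = {P(q), Q(q), R(q)}` with `q, u, v` algebraic over `K_x`, so the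
caller chooses which two of the three are algebraic. It contains the Nesterenko planes through
`π` and `π√3` as special cases (`q = e^{−2π}`: `R(q) = 0`, `P(q) = 3/π`; `q = −e^{−π√3}`:
`Q(q) = 0`).

Engine: `Literature.Barriers.Schanuel.nesterenko1996_thm_1_1_holds`
(`Literature/Barriers/Schanuel/NesterenkoModularScopeHolds.lean`, PROVED in tree): Nesterenko
1996 Theorem 1.1, `3 ≤ trdeg_ℚ ℚ(q, P(q), Q(q), R(q))` for `0 < |q| < 1`.
Bookkeeping: with `S = range x ∪ range (exp ∘ x)` and `T = {q, u, v}` algebraic over `ℚ(S) = K_x`,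
`trdeg ℚ(S ∪ T) = trdeg ℚ(S)` (`Literature.Barriers.Schanuel.trdeg_adjoin_union_eq_of_isAlgebraic_adjoin`),
`trdeg ℚ(S ∪ T ∪ {w}) ≤ trdeg ℚ(S ∪ T) + 1`
(`Literature.NumberTheory.Transcendental.trdeg_adjoin_insert_le`), and
`ℚ(q, P(q), Q(q), R(q)) ≤ ℚ(S ∪ T ∪ {w})` (monotonicity, `Literature.Barriers.Schanuel.trdeg_mono`),
so `3 ≤ trdeg K_x + 1`, i.e. `2 ≤ trdeg K_x` (`Cardinal.add_one_le_add_one_iff`).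

No definitions, no sorry; axioms `propext`, `Classical.choice`, `Quot.sound`.
-/

noncomputable section

open Complex IntermediateField

namespace Summit.Schanuel.Schanuel.Theorems

/-- **Modular-rich sector** of line `CardA_BW` for crux `SchanuelTwo`: if `K_x = ℚ(x, e^x)` has,
algebraic over it, a nome `q` with `0 < |q| < 1` together with two of Ramanujan's
`P(q), Q(q), R(q)` (written `{u, v, w} = {P(q), Q(q), R(q)}` with `q, u, v` algebraic over `K_x`),
then `2 ≤ trdeg_ℚ K_x`.
Proof: Nesterenko 1996 Theorem 1.1, tree theorem
`Literature.Barriers.Schanuel.nesterenko1996_thm_1_1_holds`, gives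
`3 ≤ trdeg_ℚ ℚ(q, P(q), Q(q), R(q))`; this field sits inside `ℚ(S ∪ T ∪ {w})`
(`S = range x ∪ range (exp ∘ x)`, `T = {q, u, v}`), whose transcendence degree is at most
`trdeg ℚ(S ∪ T) + 1 = trdeg ℚ(S) + 1 = trdeg K_x + 1` because `T` is algebraic over `ℚ(S)`.
[cite: NesterenkoPhilippon2001, Ch. 3 Theorem 1.1] -/
theorem stub_modularSector :
    ∀ (x : Fin 2 → ℂ) (q u v w : ℂ), 0 < ‖q‖ → ‖q‖ < 1 →
      ({u, v, w} : Set ℂ) = {Literature.Barriers.Schanuel.ramanujanP q,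
        Literature.Barriers.Schanuel.ramanujanQ q, Literature.Barriers.Schanuel.ramanujanR q} →
      IsAlgebraic ↥(IntermediateField.adjoin ℚ (Set.range x ∪ Set.range (Complex.exp ∘ x))) q →
      IsAlgebraic ↥(IntermediateField.adjoin ℚ (Set.range x ∪ Set.range (Complex.exp ∘ x))) u →
      IsAlgebraic ↥(IntermediateField.adjoin ℚ (Set.range x ∪ Set.range (Complex.exp ∘ x))) v →
      (2 : Cardinal) ≤ Algebra.trdeg ℚ
        ↥(IntermediateField.adjoin ℚ (Set.range x ∪ Set.range (Complex.exp ∘ x))) := by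
  intro x q u v w hq0 hq1 huvw hq hu hv
  set S : Set ℂ := Set.range x ∪ Set.range (Complex.exp ∘ x)
  set T : Set ℂ := {q, u, v}
  -- `T = {q, u, v}` is algebraic over `ℚ(S) = K_x`.
  have hT : ∀ z ∈ T, IsAlgebraic (adjoin ℚ S) z := by
    intro z hz
    simp only [T, Set.mem_insert_iff, Set.mem_singleton_iff] at hz
    rcases hz with h | h | h <;> rw [h]
    exacts [hq, hu, hv]
  -- Adjoining `T` costs nothing, adjoining `w` costs at most one.
  have h1 : Algebra.trdeg ℚ (adjoin ℚ (S ∪ T)) = Algebra.trdeg ℚ (adjoin ℚ S) :=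
    Literature.Barriers.Schanuel.trdeg_adjoin_union_eq_of_isAlgebraic_adjoin S T hT
  have h2 : Algebra.trdeg ℚ (adjoin ℚ (insert w (S ∪ T))) ≤
      Algebra.trdeg ℚ (adjoin ℚ (S ∪ T)) + 1 :=
    Literature.NumberTheory.Transcendental.trdeg_adjoin_insert_le (S ∪ T) w
  -- Nesterenko's field `ℚ(q, P(q), Q(q), R(q))` sits inside `ℚ(S ∪ T ∪ {w})`.
  have hsub : ({q, Literature.Barriers.Schanuel.ramanujanP q,
      Literature.Barriers.Schanuel.ramanujanQ q, Literature.Barriers.Schanuel.ramanujanR q} : Set ℂ) ⊆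
      insert w (S ∪ T) := by
    rw [← huvw]
    intro z hz
    simp only [Set.mem_insert_iff, Set.mem_singleton_iff] at hz
    simp only [T, Set.mem_insert_iff, Set.mem_union, Set.mem_singleton_iff]
    tauto
  have hle : adjoin ℚ ({q, Literature.Barriers.Schanuel.ramanujanP q,
      Literature.Barriers.Schanuel.ramanujanQ q, Literature.Barriers.Schanuel.ramanujanR q} : Set ℂ) ≤
      adjoin ℚ (insert w (S ∪ T)) :=
    adjoin.mono ℚ _ _ hsub
  -- Nesterenko 1996 Theorem 1.1 and the chain of inequalities.
  have h3 : (3 : Cardinal) ≤ Algebra.trdeg ℚ (adjoin ℚ S) + 1 :=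
    calc (3 : Cardinal) ≤ Algebra.trdeg ℚ (adjoin ℚ ({q, Literature.Barriers.Schanuel.ramanujanP q,
          Literature.Barriers.Schanuel.ramanujanQ q, Literature.Barriers.Schanuel.ramanujanR q} :
            Set ℂ)) :=
          Literature.Barriers.Schanuel.nesterenko1996_thm_1_1_holds q hq0 hq1
      _ ≤ Algebra.trdeg ℚ (adjoin ℚ (insert w (S ∪ T))) :=
          Literature.Barriers.Schanuel.trdeg_mono hle
      _ ≤ Algebra.trdeg ℚ (adjoin ℚ (S ∪ T)) + 1 := h2
      _ = Algebra.trdeg ℚ (adjoin ℚ S) + 1 := by rw [h1]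
  have h4 : (2 : Cardinal) + 1 ≤ Algebra.trdeg ℚ (adjoin ℚ S) + 1 := by
    have h21 : (2 : Cardinal) + 1 = 3 := by norm_num
    rw [h21]
    exact h3
  exact Cardinal.add_one_le_add_one_iff.1 h4

end Summit.Schanuel.Schanuel.Theorems

end
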